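import Literature.Probability.LatticeModels.AizenmanHiguchiFromCrossings
import Literature.Probability.LatticeModels.PlusSeaLemma
import Literature.Probability.LatticeModels.NoPlusPercolation
import HarnessLib

/-!
# Aizenman–Higuchi: per-measure forms of the final steps (GH2000, Prop. 5.1 and §5 p. 12)

Topic `Probability/LatticeModels`. Three book-keeping steps of the end of Georgii–Higuchi's proof,
stated for a single tail-trivial Gibbs measure (the forms consumed by the case analysis over the
butterflies of an extremal state):

* `ae_no_badPercolation_horizontal_of_upperGoodCrossing_bounds` — Lemma 5.5 for `μ ⊗ (μ∘θ_{se₁}⁻¹)`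
  from the upper good-crossing bound for `μ` and the one for the reflected measure `μ ∘ R⁻¹`
  (`R(x₁,x₂) = (x₁,-x₂)`), per measure (cf. `ae_no_badPercolation_horizontal_of_upperGoodCrossing_bound`,
  which assumes the bound for the whole class);
* `map_configShift_single_eq_of_ae_no_badPercolation` — Prop. 5.1 in one direction: no bad
  percolation for `v = ±e_i` gives `μ ∘ θ_{e_i}⁻¹ = μ` (`eq_of_no_bad_percolation`);
* `spinCorr_dichotomy_of_translationInvariant` — "Together with Corollary 3.2 this will immediately
  imply the main theorem": a translation invariant *tail-trivial* `μ ∈ 𝒢(β, 0)`, `β > β_c`, has the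
  correlations of `μ⁺` or of `μ⁻` (the mixture `t μ⁺ + (1-t) μ⁻` of Cor. 3.2 evaluated on the tail
  event `E⁻`, on which `μ⁺` vanishes by the plus sea lemma).

## References

* H.-O. Georgii, Y. Higuchi, *Percolation and number of phases in the two-dimensional Ising
  model*, J. Math. Phys. 41 (2000), Lemma 5.5, Prop. 5.1, Cor. 3.2, §5 p. 12 [GeorgiiHiguchi2000].
-/

noncomputable section

open MeasureTheory Filter SimpleGraph
open Literature.Probability.Percolation
open scoped ENNReal

namespace Literature.Probability.LatticeModels

variable {β : ℝ} {μ : Measure (SpinConfig (Site 2))}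

/-! ### Lemma 5.5 per measure -/

section PerMeasure

/-- The reflection `R(x₁, x₂) = (x₁, -x₂)` fixes the horizontal unit vectors. [folklore] -/
theorem reflectCoord_one_single_zero (s : ℤ) : reflectCoord 1 (Pi.single 0 s : Site 2) = Pi.single 0 s := by
  funext j
  rw [reflectCoord_apply]
  fin_cases j <;> simp

/-- **Lemma 5.5 for the horizontal translates, per measure**: for `β > β_c(2)`, a tail-trivial
`μ ∈ 𝒢(β, 0)` and `s = ±1`, the upper good-crossing bounds for `μ` and for its reflection
`μ ∘ R⁻¹` give: almost surely under `μ ⊗ (μ ∘ θ_{s e₁}⁻¹)` no lattice cluster of bad sites is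
infinite. [cite: GeorgiiHiguchi2000, Lemma 5.5 (proof, p. 16)] -/
theorem ae_no_badPercolation_horizontal_of_upperGoodCrossing_bounds (hβc : criticalBeta 2 < β)
    (hμ : μ ∈ isingGibbsMeasures 2 β 0) (hμt : IsTailTrivial μ) (s : ℤˣ)
    (hU : ∃ c : ℝ≥0∞, 0 < c ∧ ∀ n : ℕ, ∃ a₀ b₀ : ℕ, ∀ a b : ℕ, a₀ ≤ a → b₀ ≤ b →
        c ≤ (μ.prod (μ.map (configShift (Pi.single 0 (s : ℤ)))))
          {p | ∃ α : zdStarGraph.Walk (![-(a : ℤ), 0]) (![(b : ℤ), 0]),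
            ∀ z ∈ α.support, p.1 z ≤ p.2 z ∧ ¬ (-(n : ℤ) ≤ z 0 ∧ z 0 ≤ n ∧ z 1 ≤ n)})
    (hU' : ∃ c : ℝ≥0∞, 0 < c ∧ ∀ n : ℕ, ∃ a₀ b₀ : ℕ, ∀ a b : ℕ, a₀ ≤ a → b₀ ≤ b →
        c ≤ ((μ.map (configRelabel (reflectCoord (d := 2) 1).toEquiv)).prod
            ((μ.map (configRelabel (reflectCoord (d := 2) 1).toEquiv)).map (configShift (Pi.single 0 (s : ℤ)))))
          {p | ∃ α : zdStarGraph.Walk (![-(a : ℤ), 0]) (![(b : ℤ), 0]),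
            ∀ z ∈ α.support, p.1 z ≤ p.2 z ∧ ¬ (-(n : ℤ) ≤ z 0 ∧ z 0 ≤ n ∧ z 1 ≤ n)}) :
    ∀ᵐ p ∂(μ.prod (μ.map (configShift (Pi.single 0 (s : ℤ))))),
      ∀ t, ¬ (siteCluster (zdGraph 2) (spinSites 1 (badConfig p)) t).Infinite := by
  have hβ : 0 ≤ β := (criticalBeta_nonneg 2).trans hβc.le
  have hμG : IsGibbsMeasure (isingSpecification (zdGraph 2) β 0) μ := hμ
  haveI := hμG.isProbabilityMeasure
  set v : Site 2 := Pi.single 0 (s : ℤ) with hv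
  have hμv : μ.map (configShift v) ∈ isingGibbsMeasures 2 β 0 := mem_isingGibbsMeasures_map_configShift hμ v
  have hμvt : IsTailTrivial (μ.map (configShift (S := ℤˣ) v)) := hμt.map_configRelabel (Site.shift v)
  haveI : IsProbabilityMeasure (μ.map (configShift (S := ℤˣ) v)) :=
    Measure.isProbabilityMeasure_map (configShift v).measurable.aemeasurable
  obtain ⟨c, hc, hcn⟩ := hU
  obtain ⟨c', hc', hcn'⟩ := hU'
  refine ae_no_badPercolation_of_enclosure hμt hμvt (c := c * c') (ENNReal.mul_pos hc.ne' hc'.ne') fun n => ?_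
  obtain ⟨a₀, b₀, hab⟩ := hcn n
  obtain ⟨a₀', b₀', hab'⟩ := hcn' n
  set a : ℕ := max (max a₀ a₀') (n + 1) with ha
  set b : ℕ := max (max b₀ b₀') (n + 1) with hb
  have hna : n < a := by omega
  have hnb : n < b := by omega
  have hUab := hab a b (by omega) (by omega)
  have hL : c' ≤ (μ.prod (μ.map (configShift v)))
      {p : SpinConfig (Site 2) × SpinConfig (Site 2) | ∃ α : zdStarGraph.Walk (![-(a : ℤ), 0]) (![(b : ℤ), 0]),
        ∀ z ∈ α.support, p.1 z ≤ p.2 z ∧ ¬ (-(n : ℤ) ≤ z 0 ∧ z 0 ≤ n ∧ -(n : ℤ) ≤ z 1)} := by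
    rw [measure_lowerGoodCrossing_shift_eq μ v n (-(a : ℤ)) (b : ℤ), hv, reflectCoord_one_single_zero]
    exact hab' a b (by omega) (by omega)
  calc c * c' ≤ _ * _ := mul_le_mul' hUab hL
    _ ≤ _ := measure_goodCrossings_mul_le hβ hβ hμ hμt hμv hμvt hna hnb

end PerMeasure

/-! ### Prop. 5.1 in one direction -/

section Direction

/-- **Invariance under `θ_{e_i}` from the absence of bad percolation for `v = ±e_i`**
(Georgii–Higuchi 2000, Prop. 5.1, one direction at a time: "`μ̂ ≼ μ` … `μ ≼ μ̂`"). [cite: GeorgiiHiguchi2000, Prop. 5.1 (proof, p. 16)] -/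
theorem map_configShift_single_eq_of_ae_no_badPercolation (hβ : 0 ≤ β)
    (hμ : μ ∈ isingGibbsMeasures 2 β 0) (i : Fin 2)
    (h : ∀ s : ℤˣ, ∀ᵐ p ∂(μ.prod (μ.map (configShift (Pi.single i (s : ℤ))))),
      ∀ t, ¬ (siteCluster (zdGraph 2) (spinSites 1 (badConfig p)) t).Infinite) :
    μ.map (configShift (Pi.single i 1)) = μ := by
  have hμG : IsGibbsMeasure (isingSpecification (zdGraph 2) β 0) μ := hμ
  haveI := hμG.isProbabilityMeasure
  have h1 := h 1
  have h2 := h (-1)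
  simp only [Units.val_one] at h1
  have hneg : (Pi.single i ((-1 : ℤˣ) : ℤ) : Site 2) = -Pi.single i 1 := by
    rw [Units.val_neg, Units.val_one, Pi.single_neg]
  rw [hneg] at h2
  exact (eq_of_no_bad_percolation hβ hμ (mem_isingGibbsMeasures_map_configShift hμ _) h1
    (ae_no_badPercolation_prod_map_configShift _ h2)).symm

end Direction

/-! ### The dichotomy for translation invariant tail-trivial states -/

section Dichotomy

/-- **A translation invariant tail-trivial `μ ∈ 𝒢(β, 0)`, `β > β_c(2)`, is `μ⁺` or `μ⁻`** in the
sense of correlations (Georgii–Higuchi 2000, §5 p. 12: "Together with Corollary 3.2 this will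
immediately imply the main theorem"): by Cor. 3.2 `μ = t μ⁺ + (1-t) μ⁻`; on the tail event `E⁻`
(probability `0` or `1` under `μ`) the plus state vanishes (plus sea lemma), so either `μ(E⁻) = 0`
and `μ` has the plus correlations (Lemma 2.1), or `1 = (1-t) μ⁻(E⁻)` forces `t = 0`. [cite: GeorgiiHiguchi2000, Cor. 3.2 and §5 p. 12] -/
theorem spinCorr_dichotomy_of_translationInvariant (hβc : criticalBeta 2 < β)
    (hμ : μ ∈ isingGibbsMeasures 2 β 0) (hμt : IsTailTrivial μ) (hμT : IsTranslationInvariantMeasure μ) :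
    (∀ A, spinCorr μ A = plusCorr 2 β 0 A) ∨ (∀ A, spinCorr μ A = minusCorr 2 β 0 A) := by
  have hβ : 0 ≤ β := (criticalBeta_nonneg 2).trans hβc.le
  have hμG : IsGibbsMeasure (isingSpecification (zdGraph 2) β 0) μ := hμ
  haveI := hμG.isProbabilityMeasure
  -- `E⁻` has probability `0` or `1`
  rcases IsTailTrivial.measure_existsInfCluster (G := zdGraph 2) hμt (-1) with h0 | h1
  · exact Or.inl (spinCorr_eq_plusCorr_of_existsInfCluster_neg_null hβ hμ h0)
  · right
    obtain ⟨μp, μm, hμp, hμm, hp, hm, t, ht, hmix⟩ := translationInvariant_eq_mixture_two hβc hμ hμT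
    have hμpG : IsGibbsMeasure (isingSpecification (zdGraph 2) β 0) μp := hμp
    have hμmG : IsGibbsMeasure (isingSpecification (zdGraph 2) β 0) μm := hμm
    haveI := hμpG.isProbabilityMeasure
    haveI := hμmG.isProbabilityMeasure
    -- the plus state does not see `E⁻`
    have hpE : μp (existsInfCluster (zdGraph 2) (-1)) = 0 := by
      refine measure_mono_null (fun ω hω => ?_)
        (measure_existsInfCluster_star_neg_eq_zero_of_spinCorr_eq_plusCorr hβc hμp hp)
      obtain ⟨x, hx⟩ := mem_existsInfCluster_iff.1 hω
      refine mem_existsInfCluster_iff.2 ⟨x, hx.mono fun y hy => ⟨hy.1, hy.2.1, hy.2.2.mono ?_⟩⟩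
      intro a b hab
      rw [siteOpenGraph_adj] at hab ⊢
      exact ⟨zdGraph_le_zdStarGraph hab.1, hab.2.1, hab.2.2⟩
    -- evaluate the mixture on `E⁻`: `1 = (1 - t) μm(E⁻)`, so `t = 0`
    have heval : μ (existsInfCluster (zdGraph 2) (-1)) = (1 - t) * μm (existsInfCluster (zdGraph 2) (-1)) := by
      rw [hmix]
      simp [hpE]
    rw [h1] at heval
    have hmle : μm (existsInfCluster (zdGraph 2) (-1)) ≤ 1 := prob_le_one
    have ht0 : t = 0 := by
      by_contra htne
      have hlt : (1 - t) * μm (existsInfCluster (zdGraph 2) (-1)) < 1 := by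
        calc (1 - t) * μm (existsInfCluster (zdGraph 2) (-1)) ≤ (1 - t) * 1 := by gcongr
          _ = 1 - t := mul_one _
          _ < 1 := ENNReal.sub_lt_self ENNReal.one_ne_top one_ne_zero htne
      rw [← heval] at hlt
      exact lt_irrefl _ hlt
    subst ht0
    have hμeq : μ = μm := by rw [hmix]; simp
    intro A
    rw [hμeq]; exact hm A

end Dichotomy

end Literature.Probability.LatticeModels
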